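import Summits.Ventures.CertifiedManyBodySolver.Rows.SourcedTorusRows
import HarnessLib

/-!
# PINNING-FIELD rows, part 3: bridges between the energy cells and the `∀ L ≥ L₀` / `∃ L₀` energy
# inputs of the Hellmann–Feynman bracket files (library instances, `dWaveSourceTorus` at `tp = 0`)

HONEST FRAMING: first certified bounds on pairing observables; not a superconductivity verdict; every
number certified (two lineages + referee) or labelled float. Nothing is asserted here: every statement
is a proved equivalence / implication between typed shapes.

Companion of `Rows/SourcedTorusRows.lean` (cell hubbard-cq, seat hubbard-cq-obsth-1). The energy cells
there (`SourcedTorusEnergyLowerRow / UpperRow`, uniform `SourcedEnergyLowerRow / UpperRow`) are elaborated —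
like the tree soundness files — with torus sites compared through the linear order. The CONSUMERS of sourced
energy rows typed by the sibling seats use the library instances and the `tp = 0` Hamiltonian
`dWaveSourceTorus L U μ h`, in the shapes

* `∀ (L : ℕ) [NeZero L], L₀ ≤ L → ℓ · L² ≤ E₀(dWaveSourceTorus L U μ h)` — the conclusion of
  `dWaveSourceTorus_groundEnergy_ge_of_window_certificate[_d4]_eventually` (after `obtain ⟨L₀, _⟩`) and the
  CUT input of `Observables/PinningFieldResponseBracketDWave.lean` (hubbard-obs-pin-2),
  `Summit.HubbardSuperconductivity.HubbardLadder.PairSourceEnergyCert`;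
* `∃ L₀, ∀ (L : ℕ) [NeZero L], L₀ ≤ L → E₀(dWaveSourceTorus L U μ h) ≤ u · L²` — the CAP input there.

This file (NO file-local instance) proves that the cells ARE these shapes: `iff` lemmas for the one-torus
cells at every `tp` (`SourcedTorusEnergyLowerRow.iff_le_groundEnergy`, `…UpperRow.iff_groundEnergy_le`) and at
`tp = 0` onto `dWaveSourceTorus` (`…iff_dWaveSourceTorus`), and for the uniform cells the two directions
(`SourcedEnergyLowerRow.forall_dWaveSourceTorus` / `.exists_dWaveSourceTorus` / `.of_forall_dWaveSourceTorus`,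
upper twins, and `SourcedEnergyLowerRow.of_certificate_shape` consuming `(c − Σ‖aₖ‖)`-type real constants with a
rational slot `e ≤ c`). The two `DecidableEq (FermionTorus 2 L)` instances agree by `Subsingleton.elim`
(`convert`), exactly as in `dWaveSourceTorus_groundEnergy_ge_of_window_certificate_eventually`.

References: T. Koma, H. Tasaki, J. Stat. Phys. 76 (1994) 745, §1 (the sourced Hamiltonian).
-/

noncomputable section

namespace Summit.Ventures.CertifiedManyBodySolver

open Literature.MathematicalPhysics.QuantumLattice
open Matrix HubbardWave0 Literature.Probability.LatticeModels
open scoped BigOperators ComplexOrder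

variable {L : ℕ} [NeZero L] {tp U μ h : ℝ} {e : ℚ} {q L₀ : ℕ}

/-! ## One torus, every `tp`: the cells read with the library instances -/

/-- The energy FLOOR cell is the inequality `e · L² ≤ E₀(A_L)` stated with the library instances
(the file-local instance of `SourcedTorusRows.lean` and the library one agree by `Subsingleton.elim`). -/
theorem SourcedTorusEnergyLowerRow.iff_le_groundEnergy :
    SourcedTorusEnergyLowerRow L tp U μ h e ↔
      ((e : ℚ) : ℝ) * (L : ℝ) ^ 2 ≤ (dWaveSourceTorusTT' L tp U μ h).groundEnergy := by
  unfold SourcedTorusEnergyLowerRow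
  constructor <;> intro hrow <;> convert hrow using 2

/-- The energy CEILING cell is the inequality `E₀(A_L) ≤ e · L²` stated with the library instances. -/
theorem SourcedTorusEnergyUpperRow.iff_groundEnergy_le :
    SourcedTorusEnergyUpperRow L tp U μ h e ↔
      (dWaveSourceTorusTT' L tp U μ h).groundEnergy ≤ ((e : ℚ) : ℝ) * (L : ℝ) ^ 2 := by
  unfold SourcedTorusEnergyUpperRow
  constructor <;> intro hrow <;> convert hrow using 2

/-! ## One torus, `tp = 0`: the cells read on the tree's `dWaveSourceTorus` -/

/-- At `tp = 0` the FLOOR cell is `e · L² ≤ E₀(dWaveSourceTorus L U μ h)` (library instances). -/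
theorem SourcedTorusEnergyLowerRow.iff_dWaveSourceTorus :
    SourcedTorusEnergyLowerRow L 0 U μ h e ↔
      ((e : ℚ) : ℝ) * (L : ℝ) ^ 2 ≤ (dWaveSourceTorus L U μ h).groundEnergy := by
  rw [SourcedTorusEnergyLowerRow.iff_le_groundEnergy, dWaveSourceTorusTT'_zero_tp]

/-- At `tp = 0` the CEILING cell is `E₀(dWaveSourceTorus L U μ h) ≤ e · L²` (library instances). -/
theorem SourcedTorusEnergyUpperRow.iff_dWaveSourceTorus :
    SourcedTorusEnergyUpperRow L 0 U μ h e ↔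
      (dWaveSourceTorus L U μ h).groundEnergy ≤ ((e : ℚ) : ℝ) * (L : ℝ) ^ 2 := by
  rw [SourcedTorusEnergyUpperRow.iff_groundEnergy_le, dWaveSourceTorusTT'_zero_tp]

/-! ## Uniform cells ↔ the `∀ L ≥ L₀` / `∃ L₀` shapes of the bracket files -/

/-- A uniform FLOOR cell on all sides (`q = 1`) at `tp = 0` IS the cut input
`∀ L ≥ L₀, e · L² ≤ E₀(dWaveSourceTorus L U μ h)` of the Hellmann–Feynman bracket files. -/
theorem SourcedEnergyLowerRow.forall_dWaveSourceTorus (hrow : SourcedEnergyLowerRow 0 U μ h 1 L₀ e) :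
    ∀ (L : ℕ) [NeZero L], L₀ ≤ L → ((e : ℚ) : ℝ) * (L : ℝ) ^ 2 ≤ (dWaveSourceTorus L U μ h).groundEnergy :=
  fun L _ hL => SourcedTorusEnergyLowerRow.iff_dWaveSourceTorus.1 (hrow L hL (one_dvd L))

/-- The `∃ L₀` form of `SourcedEnergyLowerRow.forall_dWaveSourceTorus`. -/
theorem SourcedEnergyLowerRow.exists_dWaveSourceTorus (hrow : SourcedEnergyLowerRow 0 U μ h 1 L₀ e) :
    ∃ L₁ : ℕ, ∀ (L : ℕ) [NeZero L], L₁ ≤ L →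
      ((e : ℚ) : ℝ) * (L : ℝ) ^ 2 ≤ (dWaveSourceTorus L U μ h).groundEnergy :=
  ⟨L₀, hrow.forall_dWaveSourceTorus⟩

/-- A uniform CEILING cell on all sides (`q = 1`) at `tp = 0` IS the cap input
`∀ L ≥ L₀, E₀(dWaveSourceTorus L U μ h) ≤ e · L²` of the bracket files. -/
theorem SourcedEnergyUpperRow.forall_dWaveSourceTorus (hrow : SourcedEnergyUpperRow 0 U μ h 1 L₀ e) :
    ∀ (L : ℕ) [NeZero L], L₀ ≤ L → (dWaveSourceTorus L U μ h).groundEnergy ≤ ((e : ℚ) : ℝ) * (L : ℝ) ^ 2 :=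
  fun L _ hL => SourcedTorusEnergyUpperRow.iff_dWaveSourceTorus.1 (hrow L hL (one_dvd L))

/-- The `∃ L₀` form of `SourcedEnergyUpperRow.forall_dWaveSourceTorus` (the `hcapE` hypothesis shape of
`Observables.dWaveSource_cap_of_groundStates`). -/
theorem SourcedEnergyUpperRow.exists_dWaveSourceTorus (hrow : SourcedEnergyUpperRow 0 U μ h 1 L₀ e) :
    ∃ L₁ : ℕ, ∀ (L : ℕ) [NeZero L], L₁ ≤ L →
      (dWaveSourceTorus L U μ h).groundEnergy ≤ ((e : ℚ) : ℝ) * (L : ℝ) ^ 2 :=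
  ⟨L₀, hrow.forall_dWaveSourceTorus⟩

/-- Conversely, a `∀ L ≥ L₀` floor on `E₀(dWaveSourceTorus L U μ h)` (library instances) is the uniform
FLOOR cell at `tp = 0`, on any side progression `q`. -/
theorem SourcedEnergyLowerRow.of_forall_dWaveSourceTorus
    (hrow : ∀ (L : ℕ) [NeZero L], L₀ ≤ L →
      ((e : ℚ) : ℝ) * (L : ℝ) ^ 2 ≤ (dWaveSourceTorus L U μ h).groundEnergy) :
    SourcedEnergyLowerRow 0 U μ h q L₀ e :=
  fun L _ hL _ => SourcedTorusEnergyLowerRow.iff_dWaveSourceTorus.2 (hrow L hL)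

/-- A `∀ L ≥ L₀` ceiling on `E₀(dWaveSourceTorus L U μ h)` (library instances) is the uniform CEILING
cell at `tp = 0`, on any side progression `q`. -/
theorem SourcedEnergyUpperRow.of_forall_dWaveSourceTorus
    (hrow : ∀ (L : ℕ) [NeZero L], L₀ ≤ L →
      (dWaveSourceTorus L U μ h).groundEnergy ≤ ((e : ℚ) : ℝ) * (L : ℝ) ^ 2) :
    SourcedEnergyUpperRow 0 U μ h q L₀ e :=
  fun L _ hL _ => SourcedTorusEnergyUpperRow.iff_dWaveSourceTorus.2 (hrow L hL)

/-- **The uniform FLOOR cell from the certificate shape of record**: the conclusion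
`∀ L ≥ L₀, c' · L² ≤ E₀(dWaveSourceTorus L U μ h)` of
`dWaveSourceTorus_groundEnergy_ge_of_window_certificate[_d4]_eventually` (`c' = c − Σₖ ‖aₖ‖`, a real),
together with a rational slot `e ≤ c'`, gives `SourcedEnergyLowerRow 0 U μ h q L₀ e`. -/
theorem SourcedEnergyLowerRow.of_certificate_shape {c' : ℝ} (he : ((e : ℚ) : ℝ) ≤ c')
    (hrow : ∀ (L : ℕ) [NeZero L], L₀ ≤ L → c' * (L : ℝ) ^ 2 ≤ (dWaveSourceTorus L U μ h).groundEnergy) :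
    SourcedEnergyLowerRow 0 U μ h q L₀ e :=
  SourcedEnergyLowerRow.of_forall_dWaveSourceTorus fun L _ hL =>
    (mul_le_mul_of_nonneg_right he (by positivity)).trans (hrow L hL)

/-- The same at general `tp`, for a `∀ L ≥ L₀` floor on `E₀(dWaveSourceTorusTT' L tp U μ h)` stated with
the library instances and a real constant `c' ≥ e`. -/
theorem SourcedEnergyLowerRow.of_certificate_shape_TT' {c' : ℝ} (he : ((e : ℚ) : ℝ) ≤ c')
    (hrow : ∀ (L : ℕ) [NeZero L], L₀ ≤ L → c' * (L : ℝ) ^ 2 ≤ (dWaveSourceTorusTT' L tp U μ h).groundEnergy) :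
    SourcedEnergyLowerRow tp U μ h q L₀ e :=
  fun L _ hL _ => SourcedTorusEnergyLowerRow.iff_le_groundEnergy.2
    ((mul_le_mul_of_nonneg_right he (by positivity)).trans (hrow L hL))

/-- A uniform CEILING cell at general `tp` from a `∀ L ≥ L₀, q ∣ L` ceiling stated with the library
instances and a real constant `c' ≤ e` (e.g. the energy per site of a tiling trial state). -/
theorem SourcedEnergyUpperRow.of_forall_TT' {c' : ℝ} (he : c' ≤ ((e : ℚ) : ℝ))
    (hrow : ∀ (L : ℕ) [NeZero L], L₀ ≤ L → q ∣ L →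
      (dWaveSourceTorusTT' L tp U μ h).groundEnergy ≤ c' * (L : ℝ) ^ 2) :
    SourcedEnergyUpperRow tp U μ h q L₀ e :=
  fun L _ hL hq => SourcedTorusEnergyUpperRow.iff_groundEnergy_le.2
    ((hrow L hL hq).trans (mul_le_mul_of_nonneg_right he (by positivity)))

end Summit.Ventures.CertifiedManyBodySolver

end
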